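import Literature.NumberTheory.GaloisRepresentations.GalLayerSystemIdele
import Literature.Algebra.Homology.DiscreteRepContinuous
import HarnessLib

/-!
# `lim→_E Eˣ = F̄ˣ`: the limit of the units of the finite Galois layers is the discrete Galois module `F̄ˣ`
# (door-c4's `DiscreteRep.ofDiscreteGaloisModule (DiscreteGaloisModule.units F)`), as an isomorphism in `C_Γ`
# (Serre, *Galois Cohomology* II §1.1; Tate, C–F VII §11.1)

Topic `NumberTheory/GaloisRepresentations`; namespace `Literature.NumberTheory.GaloisRepresentations`.  Sequel to
`GalLayerSystemIdele.lean` (door-c5 g16: `unitsData F`, whose limit `(unitsData F).toSystem.toD = unitsBarD F` is the first term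
of the short exact sequence `0 → lim→ Eˣ → J̄ → C̄ → 0` of `GalLayerSystemSES.lean`) and door-c4's `DiscreteRepContinuous.lean`
(`DiscreteRep.ofDiscreteGaloisModule`), with the
tree's discrete Galois module `DiscreteGaloisModule.units F` (`UnitsCarrier F = Additive F̄ˣ`, `GaloisCohomology.lean`).
Definitions with bodies and theorems; NO named fact, no `sorry`, no instance, no notation.  Route A of crux
`AnticycControlAdditiveK` (item 19295): it identifies the first term of the limit sequence with the module `F̄ˣ` on which
door-c4's `Extʳ_{Γ_F}(N, F̄ˣ) ≃+ Hʳ(F, Hom(N, F̄ˣ))` (`DiscreteRepExtInternalHomGalois`) is stated.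

Mathematics.  Every element of `F̄` lies in a finite Galois layer (the normal closure of `F(a)`, Mathlib
`FiniteGaloisIntermediateField.adjoin`), so the injective system of inclusions `Eˣ ⊆ F̄ˣ` induces a bijection
`lim→_E Eˣ → F̄ˣ` (Mathlib `AddCommGroup.DirectLimit.lift`, `lift_injective`), which is `Γ_F`-equivariant
(`(σ|_E)(u) = σ(u)`): an isomorphism of discrete `Γ_F`-modules (Serre II §1.1: `K̄ˣ = lim→ Lˣ` as a discrete module).

## What is formalised (`F : Type` a number field, `Γ = absoluteGaloisGroup F`)

* `GalLayer.adjoin F a` (a layer containing `a`), `GalLayer.mem_adjoin`.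
* **`unitsBarToUnits F : lim→ Eˣ →+ Additive F̄ˣ`** (+ `unitsBarToUnits_of`, `_injective`, `_surjective`, `_rep`),
  **`unitsBarAddEquiv F : lim→ Eˣ ≃+ UnitsCarrier F`**, `unitsBarAddEquiv_of`, `unitsBarAddEquiv_rep`.
* **`unitsBarRepIso F : (unitsData F).toSystem.toRep ≅ Rep.of (DiscreteGaloisModule.units F).toRepresentation`** and
  **`unitsBarIso F : (unitsData F).toSystem.toD ≅ DiscreteRep.ofDiscreteGaloisModule (DiscreteGaloisModule.units F)`** (in `C_Γ`;
  the source is `unitsBarD F` of `GalLayerSystemSES.lean`).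

## References
* J.-P. Serre, *Galois Cohomology*, Springer (1997), II §1.1. [SerreGaloisCohomology1997]
* J. W. S. Cassels, A. Fröhlich (eds.), *Algebraic Number Theory* (1967), Ch. VII (J. Tate) §11.1. [CasselsFrohlichANT1967]
-/

noncomputable section

open CategoryTheory NumberField
open Field (absoluteGaloisGroup)
open Literature.Algebra.Homology
open Literature.NumberTheory.Automorphic Literature.NumberTheory.Automorphic.IdeleClassGroup
open Literature.NumberTheory.NumberFields
open scoped Classical

namespace Literature.NumberTheory.GaloisRepresentations

open IdeleClassBar

variable (F : Type) [Field F] [NumberField F]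

namespace IdeleClassBar.GalLayer

/-- **A finite Galois layer containing a given element of `F̄`** (the normal closure of `F(a)`, Mathlib
`FiniteGaloisIntermediateField.adjoin`; `F̄/F` is Galois in characteristic zero). [cite: SerreGaloisCohomology1997, II §1.1] -/
def adjoin (a : AlgebraicClosure F) : GalLayer F :=
  ⟨(FiniteGaloisIntermediateField.adjoin F ({a} : Set (AlgebraicClosure F))).toIntermediateField,
    (FiniteGaloisIntermediateField.adjoin F ({a} : Set (AlgebraicClosure F))).finiteDimensional,
    (FiniteGaloisIntermediateField.adjoin F ({a} : Set (AlgebraicClosure F))).isGalois⟩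

/-- `a ∈ adjoin F a`. [cite: SerreGaloisCohomology1997, II §1.1] -/
theorem mem_adjoin (a : AlgebraicClosure F) : a ∈ (adjoin F a).1 :=
  FiniteGaloisIntermediateField.subset_adjoin F ({a} : Set (AlgebraicClosure F)) (Set.mem_singleton a)

end IdeleClassBar.GalLayer

/-! ## `lim→ Eˣ → F̄ˣ` -/

/-- **The canonical map `lim→_E Eˣ → F̄ˣ`** (the inclusions `Eˣ ⊆ F̄ˣ` are compatible with the base changes; Mathlib
`AddCommGroup.DirectLimit.lift`). [cite: SerreGaloisCohomology1997, II §1.1] -/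
def unitsBarToUnits : (unitsData F).toSystem.limit →+ Additive (AlgebraicClosure F)ˣ :=
  AddCommGroup.DirectLimit.lift _ _ _
    (fun E : GalLayer F => MonoidHom.toAdditive (α := (E.1)ˣ) (β := (AlgebraicClosure F)ˣ)
      (Units.map (algebraMap E.1 (AlgebraicClosure F)).toMonoidHom))
    fun _ _ _ _ => Additive.toMul.injective (Units.ext rfl)

/-- `lim→ Eˣ → F̄ˣ` on a layer is the inclusion `Eˣ ⊆ F̄ˣ`. [cite: SerreGaloisCohomology1997, II §1.1] -/
theorem unitsBarToUnits_of (E : GalLayer F) (x : (unitsData F).V E) :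
    unitsBarToUnits F ((unitsData F).toSystem.of E x) =
      Additive.ofMul (Units.map (algebraMap E.1 (AlgebraicClosure F)).toMonoidHom (Additive.toMul x : (E.1)ˣ)) := by
  unfold unitsBarToUnits GalLayerSystem.of
  rw [AddCommGroup.DirectLimit.lift_of]
  rfl

/-- On `F̄`-values: `lim→ Eˣ → F̄ˣ` sends `[u]_E` to `u`. [cite: SerreGaloisCohomology1997, II §1.1] -/
theorem coe_toMul_unitsBarToUnits_of (E : GalLayer F) (x : (unitsData F).V E) :
    ((Additive.toMul (unitsBarToUnits F ((unitsData F).toSystem.of E x)) : (AlgebraicClosure F)ˣ) :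
        AlgebraicClosure F) = ((Additive.toMul x : (E.1)ˣ) : E.1) := by
  rw [unitsBarToUnits_of]
  rfl

/-- **`lim→ Eˣ → F̄ˣ` is injective** (`Eˣ ⊆ F̄ˣ` is, on every layer). [cite: SerreGaloisCohomology1997, II §1.1] -/
theorem unitsBarToUnits_injective : Function.Injective (unitsBarToUnits F) := by
  haveI := GalLayer.nonempty F
  haveI := GalLayer.isDirectedOrder F
  haveI := (unitsData F).toSystem.directedSystem
  unfold unitsBarToUnits
  refine AddCommGroup.DirectLimit.lift_injective _ _ _ fun E x y hxy => ?_
  exact (Additive.toMul (α := (E.1)ˣ)).injective (Units.ext (Subtype.ext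
    (congrArg (fun u : Additive (AlgebraicClosure F)ˣ =>
      ((Additive.toMul u : (AlgebraicClosure F)ˣ) : AlgebraicClosure F)) hxy)))

/-- **`lim→ Eˣ → F̄ˣ` is surjective** (every unit of `F̄` lies in a finite Galois layer).
[cite: SerreGaloisCohomology1997, II §1.1] -/
theorem unitsBarToUnits_surjective : Function.Surjective (unitsBarToUnits F) := fun a => by
  set u : (AlgebraicClosure F)ˣ := Additive.toMul a with hu
  have hne : (⟨(u : AlgebraicClosure F), GalLayer.mem_adjoin F (u : AlgebraicClosure F)⟩ :
      (GalLayer.adjoin F (u : AlgebraicClosure F)).1) ≠ 0 := fun h0 =>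
    u.ne_zero (congrArg Subtype.val h0)
  refine ⟨(unitsData F).toSystem.of (GalLayer.adjoin F (u : AlgebraicClosure F)) (Additive.ofMul (Units.mk0 _ hne)), ?_⟩
  rw [unitsBarToUnits_of]
  exact congrArg Additive.ofMul (Units.ext rfl)

/-- **`lim→ Eˣ → F̄ˣ` is `Γ_F`-equivariant**: `(σ|_E)(u) = σ(u)`. [cite: SerreGaloisCohomology1997, II §1.1] -/
theorem unitsBarToUnits_rep (σ : absoluteGaloisGroup F) (z : (unitsData F).toSystem.limit) :
    unitsBarToUnits F ((unitsData F).toSystem.rep σ z) =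
      Additive.ofMul ((σ : AlgebraicClosure F ≃ₐ[F] AlgebraicClosure F) •
        (Additive.toMul (unitsBarToUnits F z) : (AlgebraicClosure F)ˣ)) := by
  obtain ⟨E, x, rfl⟩ := (unitsData F).toSystem.exists_of z
  rw [GalLayerSystem.rep_of, unitsBarToUnits_of, unitsBarToUnits_of]
  refine congrArg Additive.ofMul (Units.ext ?_)
  exact GalLayer.coe_restrictHom_apply E σ _

/-! ## The isomorphism with the Galois module `F̄ˣ` -/

/-- **`lim→_E Eˣ ≃+ F̄ˣ`** (the tree's carrier `UnitsCarrier F = Additive F̄ˣ` of `DiscreteGaloisModule.units F`).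
[cite: SerreGaloisCohomology1997, II §1.1] -/
def unitsBarAddEquiv : (unitsData F).toSystem.limit ≃+ DiscreteGaloisModule.UnitsCarrier F :=
  (AddEquiv.ofBijective (unitsBarToUnits F) ⟨unitsBarToUnits_injective F, unitsBarToUnits_surjective F⟩).trans
    DiscreteGaloisModule.UnitsCarrier.toAdditive.symm

/-- Formula: `unitsBarAddEquiv = unitsBarToUnits` through `DiscreteGaloisModule.UnitsCarrier.toAdditive`.
[cite: SerreGaloisCohomology1997, II §1.1] -/
theorem toAdditive_unitsBarAddEquiv (z : (unitsData F).toSystem.limit) :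
    DiscreteGaloisModule.UnitsCarrier.toAdditive (unitsBarAddEquiv F z) = unitsBarToUnits F z := rfl

/-- **Equivariance of `lim→ Eˣ ≃+ F̄ˣ`** for the actions `(unitsData F).toSystem.rep` and `DiscreteGaloisModule.units F`.
[cite: SerreGaloisCohomology1997, II §1.1] -/
theorem unitsBarAddEquiv_rep (σ : absoluteGaloisGroup F) (z : (unitsData F).toSystem.limit) :
    unitsBarAddEquiv F ((unitsData F).toSystem.rep σ z) = DiscreteGaloisModule.units F σ (unitsBarAddEquiv F z) := by
  apply DiscreteGaloisModule.UnitsCarrier.toAdditive.injective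
  rw [DiscreteGaloisModule.units_apply_apply, toAdditive_unitsBarAddEquiv, toAdditive_unitsBarAddEquiv,
    unitsBarToUnits_rep]

/-- **`lim→ Eˣ ≅ F̄ˣ` as integral representations of `Γ_F`.** [cite: SerreGaloisCohomology1997, II §1.1] -/
def unitsBarRepIso :
    (unitsData F).toSystem.toRep ≅ Rep.of (DiscreteGaloisModule.units F).toRepresentation :=
  Rep.mkIso (Representation.Equiv.mk (unitsBarAddEquiv F).toIntLinearEquiv fun σ =>
    LinearMap.ext fun z => unitsBarAddEquiv_rep F σ z)

/-- **`lim→_E Eˣ ≅ F̄ˣ` in `C_Γ`**: the first term of the limit sequence `0 → lim→ Eˣ → J̄ → C̄ → 0` is door-c4's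
discrete Galois module `F̄ˣ`. [cite: SerreGaloisCohomology1997, II §1.1][cite: CasselsFrohlichANT1967, Ch. VII §11.1] -/
def unitsBarIso : (unitsData F).toSystem.toD ≅ DiscreteRep.ofDiscreteGaloisModule (DiscreteGaloisModule.units F) :=
  (DiscreteRep.isDiscrete ℤ (absoluteGaloisGroup F)).fullyFaithfulι.preimageIso (unitsBarRepIso F)

/-- The underlying map of `unitsBarIso` is `unitsBarAddEquiv`. [cite: SerreGaloisCohomology1997, II §1.1] -/
theorem unitsBarIso_hom_apply (z : (unitsData F).toSystem.limit) :
    (unitsBarIso F).hom.hom.hom z = unitsBarAddEquiv F z := rfl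

end Literature.NumberTheory.GaloisRepresentations

end
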